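import Mathlib
import Summits.CriticalPhenomena.SAWScalingLimit.Theses.SAWTowerCount

/-!
# KacRankPin — the level-2 corridor kernel is rank one iff `b = 5/8`

Route `SAWTowerCount`, support item `stmt-CriticalPhenomena-7257`.

For `b > 0` the level-2 corridor kernel
`K₂^b(y,y′) = b(3(4cos²πy−1)(4cos²πy′−1)+1) + 32b(b−1)cos²πy cos²πy′`
factorises as `f(y) g(y′)` iff `b = 5/8`.

* (⇐) At `b = 5/8`, `K₂ = (5/2)(1−3cos²πy)(1−3cos²πy′)` (a `ring` identity).
* (⇒) Evaluate at `y, y′ ∈ {0, 1/2}` (`cos 0 = 1`, `cos (π/2) = 0`):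
  `K₂(½,½) = 4b`, `K₂(½,0) = K₂(0,½) = −8b`, `K₂(0,0) = 32b² − 4b`; a rank-one kernel has vanishing
  `2×2` minors, so `4b(32b²−4b) = 64b²`, i.e. `16b²(8b−5) = 0`, whence `b = 5/8` since `b > 0`.
  This is the `c = 0` level-2 Kac determinant `h²(8h−5)` read in the basis `{1, cos²}`.

No named facts are used; the proof is unconditional.
-/

namespace Summit.CriticalPhenomena.SAWScalingLimit.Theorems

/-- **KacRankPin** (route `SAWTowerCount`, item `stmt-CriticalPhenomena-7257`): for every `b > 0`,
the level-2 corridor kernel `K₂^b(y,y′) = b(3(4cos²πy−1)(4cos²πy′−1)+1) + 32b(b−1)cos²πy cos²πy′`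
is of the form `f(y) g(y′)` iff `b = 5/8`. Proof: at `b = 5/8` it equals
`(5/2)(1−3cos²πy)(1−3cos²πy′)`; conversely the `2×2` minor on the points `y,y′ ∈ {0,1/2}` is
`16b²(8b−5)`, which must vanish for a product kernel. -/
theorem kacRankPin_proof :
    Summit.CriticalPhenomena.SAWScalingLimit.Theses.SAWTowerCount.KacRankPin := by
  intro b hb
  dsimp only
  have hc0 : Real.cos (Real.pi * 0) = 1 := by simp
  have hc1 : Real.cos (Real.pi * (1 / 2)) = 0 := by
    rw [show Real.pi * (1 / 2) = Real.pi / 2 by ring]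
    exact Real.cos_pi_div_two
  constructor
  · rintro ⟨f, g, hfg⟩
    have h00 := hfg (1 / 2) (1 / 2)
    have h01 := hfg (1 / 2) 0
    have h10 := hfg 0 (1 / 2)
    have h11 := hfg 0 0
    rw [hc0] at h01 h10 h11
    rw [hc1] at h00 h01 h10
    have key : (f (1 / 2) * g (1 / 2)) * (f 0 * g 0) = (f (1 / 2) * g 0) * (f 0 * g (1 / 2)) := by
      ring
    rw [← h00, ← h01, ← h10, ← h11] at key
    -- key : 4b · (32b² − 4b) = (−8b)², i.e. 16 b² (8b − 5) = 0
    have hdet : b * b * (128 * b - 80) = 0 := by nlinarith [key]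
    rcases mul_eq_zero.mp hdet with hbb | hlin
    · rcases mul_eq_zero.mp hbb with h | h <;> exact absurd h hb.ne'
    · linarith
  · intro hb'
    subst hb'
    refine ⟨fun y => 5 / 2 * (1 - 3 * Real.cos (Real.pi * y) ^ 2),
      fun y' => 1 - 3 * Real.cos (Real.pi * y') ^ 2, ?_⟩
    intro y y'
    ring

end Summit.CriticalPhenomena.SAWScalingLimit.Theorems
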